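import Literature.NumberTheory.Automorphic.UnitaryGroupTorusSiegelIntegral
import Literature.NumberTheory.Automorphic.UnitaryGroupBorelModulusThree
import Literature.NumberTheory.Automorphic.UnitaryGroupKernelFiniteSum
import Literature.MeasureTheory.Group.CoveringWeights
import HarnessLib

/-!
# Covering weights of the rational torus on the adelic torus of `U(J_N)`: translates, independence of the
# weight and translation invariance of `∫ φ(H t) w(t) dμ_T`
(Weil, *L'intégration dans les groupes topologiques* (1940), §9 — weights on quotients; Arthur, *The trace
formula in invariant form*, Ann. of Math. 114 (1981), §2: the `T`-dependence of `J^T` is a volume in the torus)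

Topic `NumberTheory/Automorphic`; namespace `Literature.NumberTheory.Automorphic.UnitaryGroup`. THEOREMS ONLY
over accepted tree modules: no definition, no named fact, no instance, no notation, no `sorry`. Plumbing half of
piece (L2-dT) of the road to the T1-qs law ★ `UnitaryGroup.TruncatedTracePolynomial` (companion:
`UnitaryGroupTorusWindowIntegral`). Letters: the adelic torus `T(𝔸_F) = torusInBorel F E c N ≤ B(𝔸_F)` (abelian,
★ `torusInBorel_comm`), its rational points `Γ_T := (rationalBorel F E c N).subgroupOf (torusInBorel F E c N)`
(`= T(𝔸_F) ∩ G(F)`) acting by LEFT multiplication, covering weights ★ `Literature.MeasureTheory.Group.IsCoveringWeight`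
(`Σ_{τ ∈ Γ_T} w(τ t) = 1`), the Borel height `H = borelHeight` read on `T(𝔸_F)`.

* §1 `countable_rationalTorusInBorel`; `borelHeight_rationalTorusInBorel_smul` (`H(τ t) = H(t)`, product formula ★
  `borelHeight_rational_borel_mul`).
* §2 `isCoveringWeight_comp_mul_left` (a translate `w(a ·)` of a covering weight is one — `T` is abelian);
  plumbing `measurableConstSMul_rationalTorusInBorel`, `smulInvariantMeasure_rationalTorusInBorel`;
  **`lintegral_weight_mul_comp_borelHeight_eq`** — `∫⁻ φ(H t) w₁(t) dμ_T = ∫⁻ φ(H t) w₂(t) dμ_T` for two covering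
  weights (★ `lintegral_mul_eq_of_coveringSum_eq`); **`lintegral_weight_mul_comp_borelHeight_mul_left`** —
  `∫⁻ φ(H t) w(t) dμ_T = ∫⁻ φ(H(a t)) w(t) dμ_T` for every `a ∈ T(𝔸_F)` and left-invariant `μ_T`.

## References

* A. Weil, *L'intégration dans les groupes topologiques et ses applications* (1940), §9.
* J. Arthur, *The trace formula in invariant form*, Ann. of Math. 114 (1981), §2 [Arthur1981TraceFormulaInvariantForm].
* J. D. Rogawski, *Automorphic Representations of Unitary Groups in Three Variables* (1990), §2.1 [Rogawski1990].
-/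

set_option autoImplicit false

noncomputable section

open MeasureTheory Measure NumberField Set Literature.MeasureTheory.Group
open scoped NNReal ENNReal Pointwise

namespace Literature.NumberTheory.Automorphic

namespace UnitaryGroup

variable {F E : Type} [Field F] [NumberField F] [Field E] [NumberField E] [Algebra F E]
  {c : E ≃ₐ[F] E} {N : ℕ}

/-! ## §1 The rational torus: countable, fixes the height -/

/-- The rational torus `Γ_T = T(𝔸_F) ∩ G(F)` (`(rationalBorel F E c N).subgroupOf (torusInBorel F E c N)`) is
countable (it injects into the countable `G(F)`). [cite: Rogawski1990, §2.1 (p. 11)] -/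
theorem countable_rationalTorusInBorel :
    Countable ((rationalBorel F E c N).subgroupOf (torusInBorel F E c N)) := by
  haveI : Countable (quasiSplit F E c N).arithmeticSubgroup := by
    haveI : Countable E := NumberField.countable' (K := E)
    haveI : Countable (Matrix (Fin N) (Fin N) E) := inferInstanceAs (Countable (Fin N → Fin N → E))
    haveI : Countable (GL (Fin N) E) := Units.val_injective.countable
    haveI : Countable (quasiSplit F E c N).Rational :=
      inferInstanceAs (Countable (rational F E c N ((StdForm.antidiagonal N).over E)))
    exact (Set.countable_range _).to_subtype
  have hinj : Function.Injective fun τ : (rationalBorel F E c N).subgroupOf (torusInBorel F E c N) =>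
      (⟨(((τ : torusInBorel F E c N) : borelAdelic F E c N) : (quasiSplit F E c N).Adelic),
        (Subgroup.mem_subgroupOf.1 τ.2 : _)⟩ : (quasiSplit F E c N).arithmeticSubgroup) := by
    intro a b h
    have h' := congrArg (fun z : (quasiSplit F E c N).arithmeticSubgroup => (z : (quasiSplit F E c N).Adelic)) h
    exact Subtype.ext (Subtype.ext (Subtype.ext h'))
  exact hinj.countable

/-- **The Borel height is invariant under the rational torus**: `H(τ t) = H(t)` for `τ ∈ T(F)`
(product formula, ★ `borelHeight_rational_borel_mul`). [cite: Rogawski1990, §2.2 (p. 13)] -/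
theorem borelHeight_rationalTorusInBorel_smul [NeZero N]
    (τ : (rationalBorel F E c N).subgroupOf (torusInBorel F E c N)) (t : torusInBorel F E c N) :
    borelHeight ((((τ • t : torusInBorel F E c N)) : borelAdelic F E c N) : (quasiSplit F E c N).Adelic) =
      borelHeight (((t : torusInBorel F E c N) : borelAdelic F E c N) : (quasiSplit F E c N).Adelic) := by
  have hmem : ((((τ : (rationalBorel F E c N).subgroupOf (torusInBorel F E c N)) : torusInBorel F E c N) :
      borelAdelic F E c N) : (quasiSplit F E c N).Adelic) ∈ (quasiSplit F E c N).arithmeticSubgroup :=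
    Subgroup.mem_subgroupOf.1 τ.2
  obtain ⟨γ, hγ⟩ := hmem
  have hγB : (quasiSplit F E c N).toAdelic γ ∈ borelAdelic F E c N := by
    rw [hγ]; exact ((τ : (rationalBorel F E c N).subgroupOf (torusInBorel F E c N)) : torusInBorel F E c N).1.2
  change borelHeight (((((τ : (rationalBorel F E c N).subgroupOf (torusInBorel F E c N)) : torusInBorel F E c N) :
      borelAdelic F E c N) : (quasiSplit F E c N).Adelic) *
    (((t : torusInBorel F E c N) : borelAdelic F E c N) : (quasiSplit F E c N).Adelic)) = _
  rw [← hγ, borelHeight_rational_borel_mul γ hγB]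

/-! ## §2 Covering weights of the rational torus: translates, and independence of the weight -/

/-- **A translate of a covering weight of `T(F)` is a covering weight** (`T(𝔸_F)` is abelian, §1).
[cite: Rogawski1990, §1.10] -/
theorem isCoveringWeight_comp_mul_left [MeasurableSpace (quasiSplit F E c N).Adelic]
    [BorelSpace (quasiSplit F E c N).Adelic] {w : torusInBorel F E c N → ℝ≥0∞}
    (hw : IsCoveringWeight ((rationalBorel F E c N).subgroupOf (torusInBorel F E c N)) w)
    (a : torusInBorel F E c N) :
    IsCoveringWeight ((rationalBorel F E c N).subgroupOf (torusInBorel F E c N))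
      (fun t : torusInBorel F E c N => w (a * t)) := by
  refine ⟨hw.measurable.comp (measurable_const_mul a), fun x => ?_⟩
  have h := hw.coveringSum_eq (a * x)
  rw [coveringSum_apply] at h ⊢
  rw [← h]
  refine tsum_congr fun τ => ?_
  change w (a * (((τ : (rationalBorel F E c N).subgroupOf (torusInBorel F E c N)) : torusInBorel F E c N) * x)) =
    w ((((τ : (rationalBorel F E c N).subgroupOf (torusInBorel F E c N)) : torusInBorel F E c N)) * (a * x))
  rw [← mul_assoc, torusInBorel_comm a, mul_assoc]

section Integral

variable [NeZero N] [MeasurableSpace (quasiSplit F E c N).Adelic] [BorelSpace (quasiSplit F E c N).Adelic]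

omit [NeZero N] in
/-- The rational torus acts measurably by left multiplication (plumbing for the weight identities of
Weil (1940), §9). [cite: Rogawski1990, §2.1 (p. 11)] -/
theorem measurableConstSMul_rationalTorusInBorel :
    MeasurableConstSMul ((rationalBorel F E c N).subgroupOf (torusInBorel F E c N)) (torusInBorel F E c N) :=
  ⟨fun τ => measurable_const_mul
    (((τ : (rationalBorel F E c N).subgroupOf (torusInBorel F E c N)) : torusInBorel F E c N))⟩

omit [NeZero N] in
/-- A left-invariant measure on the torus is invariant under the rational torus (plumbing for the weight
identities of Weil (1940), §9). [cite: Rogawski1990, §2.1 (p. 11)] -/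
theorem smulInvariantMeasure_rationalTorusInBorel (μT : Measure (torusInBorel F E c N))
    [μT.IsMulLeftInvariant] :
    SMulInvariantMeasure ((rationalBorel F E c N).subgroupOf (torusInBorel F E c N)) (torusInBorel F E c N) μT :=
  ⟨fun τ s _hs => by
    rw [show (fun x : torusInBorel F E c N => τ • x) ⁻¹' s =
        (fun x : torusInBorel F E c N =>
          (((τ : (rationalBorel F E c N).subgroupOf (torusInBorel F E c N)) : torusInBorel F E c N)) * x) ⁻¹' s
        from rfl,
      measure_preimage_mul]⟩

/-- **Independence of the weight**: for two covering weights `w₁, w₂` of `T(F)` on `T(𝔸_F)`, a left-invariant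
measure `μ_T` and measurable `φ ≥ 0` on `ℝ≥0`, `∫⁻ φ(H t) w₁(t) dμ_T = ∫⁻ φ(H t) w₂(t) dμ_T` (★
`lintegral_mul_eq_of_coveringSum_eq`: `t ↦ φ(H t)` is `T(F)`-invariant). [cite: Arthur1981TraceFormulaInvariantForm, §2] -/
theorem lintegral_weight_mul_comp_borelHeight_eq (μT : Measure (torusInBorel F E c N)) [μT.IsMulLeftInvariant]
    {w₁ w₂ : torusInBorel F E c N → ℝ≥0∞}
    (hw₁ : IsCoveringWeight ((rationalBorel F E c N).subgroupOf (torusInBorel F E c N)) w₁)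
    (hw₂ : IsCoveringWeight ((rationalBorel F E c N).subgroupOf (torusInBorel F E c N)) w₂)
    {φ : ℝ≥0 → ℝ≥0∞} (hφ : Measurable φ) :
    ∫⁻ t, φ (borelHeight (((t : torusInBorel F E c N) : borelAdelic F E c N) : (quasiSplit F E c N).Adelic)) * w₁ t ∂μT =
      ∫⁻ t, φ (borelHeight (((t : torusInBorel F E c N) : borelAdelic F E c N) : (quasiSplit F E c N).Adelic)) * w₂ t ∂μT := by
  haveI := measurableConstSMul_rationalTorusInBorel (F := F) (E := E) (c := c) (N := N)
  haveI := smulInvariantMeasure_rationalTorusInBorel (F := F) (E := E) (c := c) (N := N) μT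
  haveI := countable_rationalTorusInBorel (F := F) (E := E) (c := c) (N := N)
  have hH : Measurable fun t : torusInBorel F E c N =>
      φ (borelHeight (((t : torusInBorel F E c N) : borelAdelic F E c N) : (quasiSplit F E c N).Adelic)) :=
    hφ.comp (measurable_borelHeight.comp (measurable_subtype_coe.comp measurable_subtype_coe))
  exact lintegral_mul_eq_of_coveringSum_eq μT hH (fun τ t => by
      simp only [borelHeight_rationalTorusInBorel_smul]) hw₁.measurable hw₂.measurable
    one_ne_zero ENNReal.one_ne_top hw₁.coveringSum_eq hw₂.coveringSum_eq

/-- **Translation invariance**: for a covering weight `w` of `T(F)`, a left-invariant `μ_T`, measurable `φ ≥ 0`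
on `ℝ≥0` and ANY `a ∈ T(𝔸_F)`: `∫⁻ φ(H t) w(t) dμ_T = ∫⁻ φ(H(a t)) w(t) dμ_T` (left invariance of `μ_T` turns the
right side into `∫⁻ φ(H t) w(a⁻¹ t)`, and `w(a⁻¹ ·)` is again a covering weight).
[cite: Arthur1981TraceFormulaInvariantForm, §2] -/
theorem lintegral_weight_mul_comp_borelHeight_mul_left (μT : Measure (torusInBorel F E c N))
    [μT.IsMulLeftInvariant] {w : torusInBorel F E c N → ℝ≥0∞}
    (hw : IsCoveringWeight ((rationalBorel F E c N).subgroupOf (torusInBorel F E c N)) w)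
    {φ : ℝ≥0 → ℝ≥0∞} (hφ : Measurable φ) (a : torusInBorel F E c N) :
    ∫⁻ t, φ (borelHeight (((t : torusInBorel F E c N) : borelAdelic F E c N) : (quasiSplit F E c N).Adelic)) * w t ∂μT =
      ∫⁻ t, φ (borelHeight ((((a * t : torusInBorel F E c N)) : borelAdelic F E c N) :
        (quasiSplit F E c N).Adelic)) * w t ∂μT := by
  have h1 := lintegral_weight_mul_comp_borelHeight_eq μT hw (isCoveringWeight_comp_mul_left hw a⁻¹) hφ
  rw [h1]
  have h2 := lintegral_mul_left_eq_self (μ := μT) (fun t : torusInBorel F E c N =>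
    φ (borelHeight (((t : torusInBorel F E c N) : borelAdelic F E c N) : (quasiSplit F E c N).Adelic)) *
      w (a⁻¹ * t)) a
  rw [← h2]
  refine lintegral_congr fun t => ?_
  simp only [inv_mul_cancel_left]

end Integral



end UnitaryGroup

end Literature.NumberTheory.Automorphic
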